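import Mathlib
import Summits.NavierStokesRegularity.NavierStokesRegularity.Theorems.FilamentSkeletonRssStadiumKernelPieces
import Summits.NavierStokesRegularity.NavierStokesRegularity.Theorems.FilamentSkeletonRssNearDiagonalLogIntegral

/-!
# Route `FilamentSkeletonRss` · child crux `TangentSkeletonNearStraightL` (stmt-NavierStokesRegularity-23320) · registered line
# `child_tangent_analytic_strip_L` (b0b56c52900dd90a), stub `stub_stripPropagation` — brick: THE NEAR-DIAGONAL KERNEL BOUND AND ITS INTEGRAL

Composition of the landed pieces into the quantitative half of R7 (STUB-PLAN memo attached to 23320).  On the shifted near-diagonal segment the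
complexified matched integrand is `((Q + κ·G)^{3/2})⁻¹ • num` with `Re Q ≥ c·s²` (`Theorems.StadiumChord`, `c = 1 − 6η²`), `Re G ≥ A/2 ≥ Λ⁻¹/2`
(`StadiumAnalyticArea` and the core-area floor), `‖num‖ ≤ 2B₁K₂s²` (`Theorems.StadiumCauchyNumerator`):
* `near_kernel_norm_le` — pointwise: `‖((Q + κG)^{3/2})⁻¹ • num‖ ≤ 2B₁K₂ · s²/(c s² + κ/(2Λ))^{3/2}` (principal branch, `Theorems.StadiumKernelPieces`);
* `near_kernel_integral_le` — the integral of that majorant over `s ∈ [−R, R]`: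
  `∫_{−R}^{R} 2B₁K₂·s²/(c s² + μ²)^{3/2} ds ≤ 4B₁K₂·(1/3 + log(R√c/μ))/c^{3/2}` for `μ/√c ≤ R` (`Theorems.NearDiagonalLogIntegral`; `μ² = κ/(2Λ)`).
With `B₁ = 2`, `K₂ = 4/hs`, `hs = cs√Γ`, `R ≤ hs` this is `O(log Γ / (cs√Γ))`, and the prefactor `Γθ₀⁻¹/(4π)` of the stub gives `Cu·√Γ·log Γ`.
HONEST FRAMING: bricks for a plan about a HYPOTHETICAL filament skeleton on the NEGATIVE side of a MODEL route; the stub `stub_stripPropagation` is NOT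
closed; nothing here bears on Navier–Stokes regularity or blow-up.  `--supports stmt-NavierStokesRegularity-23320`.
-/

set_option linter.dupNamespace false

noncomputable section

namespace Summit.NavierStokesRegularity.NavierStokesRegularity.Theorems.StadiumNearKernelBound

open Set MeasureTheory intervalIntegral

/-- **Pointwise near-diagonal kernel bound (principal branch).**  `Re Q ≥ c s²` (`c ≥ 0`), `Re G ≥ A/2`, `Λ⁻¹ ≤ A`, `0 < κ`, `0 < Λ`,
`‖num‖ ≤ 2B₁K₂s²`: then `‖((Q + κG)^{3/2})⁻¹ • num‖ ≤ 2B₁K₂·s²·(c s² + κ/(2Λ))^{−3/2}`. [folklore] -/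
theorem near_kernel_norm_le {Q Gv : ℂ} {num : Fin 3 → ℂ} {c s κ Λ A B₁ K₂ : ℝ} (hκ : 0 < κ) (hΛ : 0 < Λ) (hA : Λ⁻¹ ≤ A)
    (hc : 0 ≤ c) (hQ : c * s ^ 2 ≤ Q.re) (hG : A / 2 ≤ Gv.re) (hnum : ‖num‖ ≤ 2 * B₁ * K₂ * s ^ 2) :
    ‖((Q + (κ : ℂ) * Gv) ^ ((3:ℂ) / 2))⁻¹ • num‖ ≤
      (c * s ^ 2 + κ / (2 * Λ)) ^ (-(3/2 : ℝ)) * (2 * B₁ * K₂ * s ^ 2) := by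
  set w : ℂ := Q + (κ : ℂ) * Gv with hw
  have hm0 : 0 < c * s ^ 2 + κ / (2 * Λ) := by positivity
  have hwre : c * s ^ 2 + κ / (2 * Λ) ≤ w.re := by
    have h1 : w.re = Q.re + κ * Gv.re := by simp [hw, Complex.add_re]
    rw [h1]
    have h2 : κ / (2 * Λ) ≤ κ * Gv.re := by
      have h3 : Λ⁻¹ / 2 ≤ Gv.re := by linarith
      calc κ / (2 * Λ) = κ * (Λ⁻¹ / 2) := by field_simp
        _ ≤ κ * Gv.re := mul_le_mul_of_nonneg_left h3 hκ.le
    linarith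
  have hwpos : 0 < w.re := hm0.trans_le hwre
  have hker : ‖(w ^ ((3:ℂ) / 2))⁻¹‖ ≤ (c * s ^ 2 + κ / (2 * Λ)) ^ (-(3/2 : ℝ)) :=
    (Summit.NavierStokesRegularity.NavierStokesRegularity.Theorems.StadiumKernelPieces.norm_inv_cpow_threeHalves_le hwpos).trans
      (Real.rpow_le_rpow_of_nonpos hm0 hwre (by norm_num))
  have hnum0 : 0 ≤ 2 * B₁ * K₂ * s ^ 2 := (norm_nonneg _).trans hnum
  rw [norm_smul]
  exact mul_le_mul hker hnum (norm_nonneg _) (Real.rpow_nonneg hm0.le _)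

/-- The majorant in the form of `Theorems.NearDiagonalLogIntegral`: `(c s² + μ²)^{−3/2}·(2B₁K₂s²) = 2B₁K₂ · s²/(c s² + μ²)^{3/2}`. [folklore] -/
theorem majorant_eq {c s μ B₁ K₂ : ℝ} (hm : 0 ≤ c * s ^ 2 + μ ^ 2) :
    (c * s ^ 2 + μ ^ 2) ^ (-(3/2 : ℝ)) * (2 * B₁ * K₂ * s ^ 2) =
      2 * B₁ * K₂ * (s ^ 2 / (c * s ^ 2 + μ ^ 2) ^ (3/2 : ℝ)) := by
  rw [Real.rpow_neg hm]
  ring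

/-- **Integrated near-diagonal kernel bound.**  For `0 < c`, `0 < μ`, `μ/√c ≤ R`, `0 ≤ B₁K₂`:
`∫_{−R}^{R} 2B₁K₂·s²/(c s² + μ²)^{3/2} ds ≤ 4B₁K₂·(1/3 + log(R√c/μ))/c^{3/2}`. [folklore] -/
theorem near_kernel_integral_le {c μ R B₁ K₂ : ℝ} (hc : 0 < c) (hμ : 0 < μ) (hR : μ / Real.sqrt c ≤ R) (hBK : 0 ≤ B₁ * K₂) :
    ∫ s in (-R)..R, 2 * B₁ * K₂ * (s ^ 2 / (c * s ^ 2 + μ ^ 2) ^ (3/2 : ℝ)) ≤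
      4 * (B₁ * K₂) * ((1/3 + Real.log (R * Real.sqrt c / μ)) / c ^ (3/2 : ℝ)) := by
  set f : ℝ → ℝ := fun s => s ^ 2 / (c * s ^ 2 + μ ^ 2) ^ (3/2 : ℝ) with hf
  have hR0 : 0 < R := (div_pos hμ (Real.sqrt_pos.2 hc)).trans_le hR
  have hden_pos : ∀ s : ℝ, 0 < (c * s ^ 2 + μ ^ 2) ^ (3/2 : ℝ) := fun s =>
    Real.rpow_pos_of_pos (by positivity) _
  have hf_cont : Continuous f := by
    have h1 : Continuous fun s : ℝ => (c * s ^ 2 + μ ^ 2) ^ (3/2 : ℝ) :=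
      Continuous.rpow_const (by fun_prop) fun s => Or.inr (by norm_num)
    exact (continuous_pow 2).div h1 fun s => (hden_pos s).ne'
  have hfi : ∀ a b : ℝ, IntervalIntegrable f volume a b := fun a b => hf_cont.intervalIntegrable a b
  have heven : ∀ s, f (-s) = f s := fun s => by simp [hf]
  have hhalf := Summit.NavierStokesRegularity.NavierStokesRegularity.Theorems.NearDiagonalLogIntegral.integral_sq_div_rpow_threeHalves_le
    hc hμ hR
  -- `∫_{-R}^{R} f = 2 ∫_0^R f`
  have hsplit : ∫ s in (-R)..R, f s = 2 * ∫ s in (0:ℝ)..R, f s := by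
    rw [← integral_add_adjacent_intervals (hfi (-R) 0) (hfi 0 R)]
    have h1 : ∫ s in (-R)..0, f s = ∫ s in (0:ℝ)..R, f s := by
      have h2 : ∫ s in (-R)..0, f s = ∫ s in (-R)..0, f (-s) := by
        refine integral_congr fun s _ => (heven s).symm
      rw [h2, intervalIntegral.integral_comp_neg]
      simp
    rw [h1]; ring
  rw [intervalIntegral.integral_const_mul, hsplit]
  have h2BK : 0 ≤ 2 * B₁ * K₂ := by linarith
  calc 2 * B₁ * K₂ * (2 * ∫ s in (0:ℝ)..R, f s) = 4 * (B₁ * K₂) * ∫ s in (0:ℝ)..R, f s := by ring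
    _ ≤ 4 * (B₁ * K₂) * ((1/3 + Real.log (R * Real.sqrt c / μ)) / c ^ (3/2 : ℝ)) :=
        mul_le_mul_of_nonneg_left hhalf (by positivity)

end Summit.NavierStokesRegularity.NavierStokesRegularity.Theorems.StadiumNearKernelBound

end
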